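import Summits.QuantumFields.YangMills.Theorems.BalabanUVNodesN12SegmentPlaqFamilyAtRecord
import HarnessLib

/-!
# BalabanUVNodes ∕ N12 — THE (σ)_N CAPSTONE, EXPLICIT: budgets `θ_j := κ·Σ_{l<j} Lˡ` chosen, no-wrap and radii folded into a level guard and `M₁ ≥ C(d,L)·L²` — the (σ)_N letter of record modulo
# CLASS, DATUM, REGION GEOMETRY and four displayed numeric inequalities

Cell `pub-ymgap` (HUMAN RULINGS D-0062 ∕ D-0149), WIDTH SEAT `pub-ymgap-dag-n12-w3` g4 (node N12 = [B15]; key K1⁹ `stmt-QuantumFields-27364` (KEY MAP v2), `--kind proof --supports … --as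
helper`; count-neutral).  THEOREMS ONLY (0 `def`, 0 `instance`, 0 `sorry`); consumed BY NAME: `N12SegmentPlaqFamilyAtRecord.exists_gaugeLetterLoc_atRecord_of_class_geometry`,
`N12GaugeLetterLocNumerics.noWrap_of_levelGuard` ∕ `radius_le_of_M₁_ge`.

WHY.  `…_of_class_geometry` displays the tower budgets `θ` (any solution of `6·(((d+2)L)²∕4)·a + L·θ_j ≤ θ_{j+1}`, `a = 2εregL²`), the no-wrap inequality `hN` and the radius inequalities `hRad`.
THIS FILE picks `θ_j := κ·Σ_{l<j} Lˡ` (`κ = 6·(((d+2)L)²∕4)·(2εregL²)`; the recursion holds with equality, `θ₀ = 0`) and reads `hN`, `hRad`, `2 ≤ M₁` off dag-n12-w3's numerics file: ★★★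
`exists_gaugeLetterLoc_atRecord_explicit` — the (σ)_N letter of record at `𝐁_k(Z)` with tolerance `max ρn (((2ℓ_k+1+m′L^k)²∕4)·(εreg·η₀²) + m′·κ·Σ_{l<k} Lˡ + m′·ρn)`, RESIDUE: the minimiser in
NODE 00's class, the region datum `W 𝒞 ρn`, the region's geometry letters `hGN` ∕ `hN1` ∕ `hGmem`, and NUMERICS: `0 < εreg`, Prop. 2's two smallness conditions and the chart condition on `εreg`,
a level guard `k + c ≤ m + K` with `4d + m′ + 3 < 2L^c`, `M₁ ≥ (4d+m′)L² + 2dL + 12`, `M₁ ≥ ((d+4)L+6)L²`, cover divisibility.  SCALING (honest): `η₀ = 1` and `Σ_{l<k} Lˡ ∼ L^{k−1}` make the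
tolerance `∼ (L^{2k} + L^{k+1})·εreg` — the scale-0 edition is crude; print's per-level scaling needs the graded-tolerance producer (lane word «keep both editions»).

HONEST FRAMING.  Arithmetic + composition by name; the minimiser ([15] Thm 1 ∕ (E)), the region datum, the region geometry letters and the numerics stay HYPOTHESES; nothing of Bałaban's asserted
beyond cited tree theorems; count-neutral; N12 NOT discharged; K1⁹ NOT closed; counts unmoved (typed 28∕28 · discharged 5∕27); one finite 𝕋⁴ programme at fixed ε — R4 closes the conditional
rung `BalabanLadder.UV` only; the Yang–Mills mass gap (Clay) is NOT proved by any of this; nothing continuum ∕ ℝ⁴ ∕ OS.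
-/

noncomputable section

open scoped Matrix.Norms.L2Operator BigOperators

namespace Summit.QuantumFields.YangMills.BalabanUVNodes.N12GaugeLetterLocExplicit

open Literature.MathematicalPhysics.QuantumFieldTheory.Balaban1983to89
open T4Continuum GaugeField B15DeterminingSets BlockAveraging
open T4CubeChartGnomonic (SU2)
open B16Sect1Backgrounds (toMS)
open B14.Eq213MaximalDomains (side)
open B14.Eq213DetSet (Bj maxDomT)
open B14.Eq216Concrete (inputs)
open B14.Eq22Determines (blockIter)
open B8Eq17ClassAkV1 (plaqsOf)
open ExpMeanLog (deltaSU)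
open Literature.MathematicalPhysics.QuantumFieldTheory.BalabanImbrieJaffe1984to88.BIJ85Eq453GaugeField (qsstarGIter0)
open Summit.QuantumFields.YangMills.BalabanUVNodes.N12GaugeLetterLocNumerics (noWrap_of_levelGuard radius_le_of_M₁_ge)
open Summit.QuantumFields.YangMills.BalabanUVNodes.N12SegmentPlaqFamilyAtRecord (exists_gaugeLetterLoc_atRecord_of_class_geometry)

variable {P : Params}

/-- The chosen budgets solve the tower recursion with equality: `κ·Σ_{l<j+1} Lˡ = κ + L·(κ·Σ_{l<j} Lˡ)`. [folklore] -/
theorem budget_succ (L : ℕ) (κ : ℝ) (j : ℕ) :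
    κ * ∑ i ∈ Finset.range (j + 1), (L : ℝ) ^ i = κ + (L : ℝ) * (κ * ∑ i ∈ Finset.range j, (L : ℝ) ^ i) := by
  rw [Finset.sum_range_succ', pow_zero, mul_add, mul_one, add_comm, Finset.mul_sum, Finset.mul_sum, Finset.mul_sum]
  congr 1
  refine Finset.sum_congr rfl fun i _ => ?_
  ring

/-- ★★★ **THE (σ)_N LETTER OF RECORD, EXPLICIT.**  `N12SegmentPlaqFamilyAtRecord.exists_gaugeLetterLoc_atRecord_of_class_geometry` with the budgets `θ_j := κ·Σ_{l<j} Lˡ` and the no-wrap ∕ radius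
numerics folded (dag-n12-w3's `noWrap_of_levelGuard`, `radius_le_of_M₁_ge`).  RESIDUE: CLASS (`hmin`), DATUM (`W 𝒞 ρn`), REGION GEOMETRY (`hGN`, `hN1`, `hGmem`), NUMERICS (`εreg`; level guard;
two lower bounds on `M₁`; cover divisibility).
[cite: Balaban1985Variational, (2)–(4) p.278, (16)–(18) p.280; Balaban1985RegularSpaces, (1.7) p.77, (1.19) p.79; Balaban1985Averaging, Prop. 2 (52)–(53) p.26; Balaban1988Convergent, (2.12)–(2.13) pp.256–257, (2.16) p.257, p.267] -/
theorem exists_gaugeLetterLoc_atRecord_explicit {F : T4Family} (ν : Node00.Stage7Numerics) (Kt : ℕ) {k : ℕ} (hk0 : 0 < k) (hk : k ≤ (F.P Kt).m + (F.P Kt).K)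
    (hdiv : side (F.P Kt).L ν.M₁ k ∣ (F.P Kt).sitesPerDir 0) (Z : Set (Site (F.P Kt) 0))
    -- NUMERICS (i): a level guard `k + c ≤ m + K` with `4d + m′ + 3 < 2·L^c` (no wrapping), and `M₁ ≥ (4d + m′)·L² + 2d·L + 12` (radii), `m′ = 3·(d·((L−1)∕2)) + 5`
    {c : ℕ} (hkc : k + c ≤ (F.P Kt).m + (F.P Kt).K) (hc : 4 * (F.P Kt).d + (3 * ((F.P Kt).d * (((F.P Kt).L - 1) / 2)) + 5) + 3 < 2 * (F.P Kt).L ^ c)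
    (hMrad : (4 * (F.P Kt).d + (3 * ((F.P Kt).d * (((F.P Kt).L - 1) / 2)) + 5)) * (F.P Kt).L ^ 2 + 2 * (F.P Kt).d * (F.P Kt).L + 12 ≤ ν.M₁)
    -- the region-normalised datum and the minimiser
    {ρn : ℝ} (hρn : 0 ≤ ρn)
    (W : GaugeField (F.P Kt) k SU2) (𝒞 : Set (PBond (F.P Kt) k)) (hD : ∀ c ∈ 𝒞, dist1 (W c) ≤ ρn)
    {U₀ : GaugeField (F.P Kt) 0 SU2}
    (hmin : IsMinimizer (Node00.avOfRecord F 2 Kt) (Node00.regMSCoPOfRecord F 2 ν Kt k (maxDomT ν.M₁ Z)) (Bj ν.M₁ Z k)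
      (avgFamily (Node00.avOfRecord F 2 Kt) (qsstarGIter0 k W)) U₀)
    -- geometry of the neighbourhood (dag-n12-w6's letters, verbatim)
    (N : Set (PBond (F.P Kt) 0))
    (hGN : ∀ b ∈ N, (b.src ∉ maxDomT ν.M₁ Z 1 ∨ b.tgt ∉ maxDomT ν.M₁ Z 1) → blockIter k b.tgt ≠ blockIter k b.src →
      (⟨blockIter k b.src, b.dir⟩ : PBond (F.P Kt) k) ∈ 𝒞)
    (hN1 : ∀ p : Plaq (F.P Kt) 0, ((⟨p.src, p.μ⟩ : PBond (F.P Kt) 0) ∈ {b : PBond (F.P Kt) 0 | b.src ∈ maxDomT ν.M₁ Z 1} ∨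
        (⟨p.src.shift p.μ, p.ν⟩ : PBond (F.P Kt) 0) ∈ {b : PBond (F.P Kt) 0 | b.src ∈ maxDomT ν.M₁ Z 1} ∨
        (⟨p.src.shift p.ν, p.μ⟩ : PBond (F.P Kt) 0) ∈ {b : PBond (F.P Kt) 0 | b.src ∈ maxDomT ν.M₁ Z 1} ∨
        (⟨p.src, p.ν⟩ : PBond (F.P Kt) 0) ∈ {b : PBond (F.P Kt) 0 | b.src ∈ maxDomT ν.M₁ Z 1}) →
      (⟨p.src, p.μ⟩ : PBond (F.P Kt) 0) ∈ N ∧ (⟨p.src.shift p.μ, p.ν⟩ : PBond (F.P Kt) 0) ∈ N ∧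
        (⟨p.src.shift p.ν, p.μ⟩ : PBond (F.P Kt) 0) ∈ N ∧ (⟨p.src, p.ν⟩ : PBond (F.P Kt) 0) ∈ N)
    -- the class threshold `εreg`: positive and small ([Balaban1985Averaging] Prop. 2's smallness at `α₀ := εreg·L²`)
    (hεpos : 0 < ν.εreg)
    (hα3 : (143 * (((((F.P Kt).d + 4 : ℕ) : ℝ)) ^ 2 / 4) ^ 2) * (ν.εreg * (F.P Kt).L ^ 2) ≤ 1 / 3)
    (hα2 : 2 * (ν.εreg * (F.P Kt).L ^ 2) ≤ 2 * deltaSU (Fin 2) / ((((F.P Kt).d + 4) * (F.P Kt).L : ℕ) : ℝ) ^ 2)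
    (haN : (((((F.P Kt).d + 2) * (F.P Kt).L : ℕ) : ℝ) ^ 2 / 4) * (2 * (ν.εreg * (F.P Kt).L ^ 2)) < deltaSU (Fin 2))
    -- the family's support numerics: `M₁ ≥ ((d+4)L + 6)·L²`
    (hM₁ : (((F.P Kt).d + 4) * (F.P Kt).L + 6) * (F.P Kt).L ^ 2 ≤ ν.M₁)
    -- GEOMETRY instead of the datum letter: the `k`-shadows of the face-crossing members of `𝐁_k(Z)` lie in `𝒞`
    (hGmem : ∀ i ≤ k, ∀ c ∈ bondsOf ((Bj ν.M₁ Z k : DetSet (F.P Kt)) i), blockIter k (embIter i c.tgt) ≠ blockIter k (embIter i c.src) →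
      (⟨blockIter k (embIter i c.src), c.dir⟩ : PBond (F.P Kt) k) ∈ 𝒞) :
    ∃ σ : GaugeTransf (F.P Kt) 0 SU2,
      (∀ j, j ≤ k → ∀ b ∈ bondsOf (Bj ν.M₁ Z k j), toMS σ j b.src = 1 ∧ toMS σ j b.tgt = 1) ∧
        (∀ p : Plaq (F.P Kt) 0, ((⟨p.src, p.μ⟩ : PBond (F.P Kt) 0) ∈ {b : PBond (F.P Kt) 0 | b.src ∈ maxDomT ν.M₁ Z 1} ∨
            (⟨p.src.shift p.μ, p.ν⟩ : PBond (F.P Kt) 0) ∈ {b : PBond (F.P Kt) 0 | b.src ∈ maxDomT ν.M₁ Z 1} ∨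
            (⟨p.src.shift p.ν, p.μ⟩ : PBond (F.P Kt) 0) ∈ {b : PBond (F.P Kt) 0 | b.src ∈ maxDomT ν.M₁ Z 1} ∨
            (⟨p.src, p.ν⟩ : PBond (F.P Kt) 0) ∈ {b : PBond (F.P Kt) 0 | b.src ∈ maxDomT ν.M₁ Z 1}) →
          ‖((gaugeAct σ U₀ ⟨p.src, p.μ⟩ : SU2) : Matrix (Fin 2) (Fin 2) ℂ) - 1‖ ≤
              max ρn ((((2 * (∑ i ∈ Finset.range (k + 1), ((F.P Kt).d * (((F.P Kt).L ^ i - 1) / 2) + 1)) + 1 +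
                  (3 * ((F.P Kt).d * (((F.P Kt).L - 1) / 2)) + 5) * (F.P Kt).L ^ k : ℕ) : ℝ)) ^ 2 / 4 * (ν.εreg * (F.P Kt).eta 0 ^ 2) +
                ((3 * ((F.P Kt).d * (((F.P Kt).L - 1) / 2)) + 5 : ℕ) : ℝ) * (6 * ((((((F.P Kt).d + 2) * (F.P Kt).L : ℕ) : ℝ) ^ 2 / 4) * (2 * (ν.εreg * (F.P Kt).L ^ 2))) * ∑ i ∈ Finset.range k, ((F.P Kt).L : ℝ) ^ i) + ((3 * ((F.P Kt).d * (((F.P Kt).L - 1) / 2)) + 5 : ℕ) : ℝ) * ρn) ∧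
            ‖((gaugeAct σ U₀ ⟨p.src.shift p.μ, p.ν⟩ : SU2) : Matrix (Fin 2) (Fin 2) ℂ) - 1‖ ≤
              max ρn ((((2 * (∑ i ∈ Finset.range (k + 1), ((F.P Kt).d * (((F.P Kt).L ^ i - 1) / 2) + 1)) + 1 +
                  (3 * ((F.P Kt).d * (((F.P Kt).L - 1) / 2)) + 5) * (F.P Kt).L ^ k : ℕ) : ℝ)) ^ 2 / 4 * (ν.εreg * (F.P Kt).eta 0 ^ 2) +
                ((3 * ((F.P Kt).d * (((F.P Kt).L - 1) / 2)) + 5 : ℕ) : ℝ) * (6 * ((((((F.P Kt).d + 2) * (F.P Kt).L : ℕ) : ℝ) ^ 2 / 4) * (2 * (ν.εreg * (F.P Kt).L ^ 2))) * ∑ i ∈ Finset.range k, ((F.P Kt).L : ℝ) ^ i) + ((3 * ((F.P Kt).d * (((F.P Kt).L - 1) / 2)) + 5 : ℕ) : ℝ) * ρn) ∧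
            ‖((gaugeAct σ U₀ ⟨p.src.shift p.ν, p.μ⟩ : SU2) : Matrix (Fin 2) (Fin 2) ℂ) - 1‖ ≤
              max ρn ((((2 * (∑ i ∈ Finset.range (k + 1), ((F.P Kt).d * (((F.P Kt).L ^ i - 1) / 2) + 1)) + 1 +
                  (3 * ((F.P Kt).d * (((F.P Kt).L - 1) / 2)) + 5) * (F.P Kt).L ^ k : ℕ) : ℝ)) ^ 2 / 4 * (ν.εreg * (F.P Kt).eta 0 ^ 2) +
                ((3 * ((F.P Kt).d * (((F.P Kt).L - 1) / 2)) + 5 : ℕ) : ℝ) * (6 * ((((((F.P Kt).d + 2) * (F.P Kt).L : ℕ) : ℝ) ^ 2 / 4) * (2 * (ν.εreg * (F.P Kt).L ^ 2))) * ∑ i ∈ Finset.range k, ((F.P Kt).L : ℝ) ^ i) + ((3 * ((F.P Kt).d * (((F.P Kt).L - 1) / 2)) + 5 : ℕ) : ℝ) * ρn) ∧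
            ‖((gaugeAct σ U₀ ⟨p.src, p.ν⟩ : SU2) : Matrix (Fin 2) (Fin 2) ℂ) - 1‖ ≤
              max ρn ((((2 * (∑ i ∈ Finset.range (k + 1), ((F.P Kt).d * (((F.P Kt).L ^ i - 1) / 2) + 1)) + 1 +
                  (3 * ((F.P Kt).d * (((F.P Kt).L - 1) / 2)) + 5) * (F.P Kt).L ^ k : ℕ) : ℝ)) ^ 2 / 4 * (ν.εreg * (F.P Kt).eta 0 ^ 2) +
                ((3 * ((F.P Kt).d * (((F.P Kt).L - 1) / 2)) + 5 : ℕ) : ℝ) * (6 * ((((((F.P Kt).d + 2) * (F.P Kt).L : ℕ) : ℝ) ^ 2 / 4) * (2 * (ν.εreg * (F.P Kt).L ^ 2))) * ∑ i ∈ Finset.range k, ((F.P Kt).L : ℝ) ^ i) + ((3 * ((F.P Kt).d * (((F.P Kt).L - 1) / 2)) + 5 : ℕ) : ℝ) * ρn)) ∧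
        (∀ b ∈ inputs (Bj ν.M₁ Z k), b ∈ N →
          ‖((gaugeAct σ U₀ b : SU2) : Matrix (Fin 2) (Fin 2) ℂ) - 1‖ ≤
              max ρn ((((2 * (∑ i ∈ Finset.range (k + 1), ((F.P Kt).d * (((F.P Kt).L ^ i - 1) / 2) + 1)) + 1 +
                  (3 * ((F.P Kt).d * (((F.P Kt).L - 1) / 2)) + 5) * (F.P Kt).L ^ k : ℕ) : ℝ)) ^ 2 / 4 * (ν.εreg * (F.P Kt).eta 0 ^ 2) +
                ((3 * ((F.P Kt).d * (((F.P Kt).L - 1) / 2)) + 5 : ℕ) : ℝ) * (6 * ((((((F.P Kt).d + 2) * (F.P Kt).L : ℕ) : ℝ) ^ 2 / 4) * (2 * (ν.εreg * (F.P Kt).L ^ 2))) * ∑ i ∈ Finset.range k, ((F.P Kt).L : ℝ) ^ i) + ((3 * ((F.P Kt).d * (((F.P Kt).L - 1) / 2)) + 5 : ℕ) : ℝ) * ρn)) := by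
  have hL2 : 2 ≤ (F.P Kt).L := (F.P Kt).hL.2
  have hM2 : 2 ≤ ν.M₁ := by
    have h4 : 4 ≤ (F.P Kt).L ^ 2 := by nlinarith [hL2]
    have h6 : 6 ≤ ((F.P Kt).d + 4) * (F.P Kt).L + 6 := by omega
    have h24 : 24 ≤ (((F.P Kt).d + 4) * (F.P Kt).L + 6) * (F.P Kt).L ^ 2 := Nat.mul_le_mul h6 h4
    omega
  have hN := noWrap_of_levelGuard (P := F.P Kt) hkc hc
  have hRad := radius_le_of_M₁_ge (P := F.P Kt) (k := k) hMrad
  have hκ0 : 0 ≤ 6 * ((((((F.P Kt).d + 2) * (F.P Kt).L : ℕ) : ℝ) ^ 2 / 4) * (2 * (ν.εreg * (F.P Kt).L ^ 2))) := by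
    have := hεpos.le; positivity
  exact exists_gaugeLetterLoc_atRecord_of_class_geometry ν Kt hk0 hk hM2 hdiv Z hN hRad hρn W 𝒞 hD hmin N hGN hN1 hεpos hα3 hα2 haN
    (fun j => (6 * ((((((F.P Kt).d + 2) * (F.P Kt).L : ℕ) : ℝ) ^ 2 / 4) * (2 * (ν.εreg * (F.P Kt).L ^ 2))) * ∑ i ∈ Finset.range j, ((F.P Kt).L : ℝ) ^ i))
    (by simp) (fun j => (budget_succ (F.P Kt).L _ j).symm.le) hM₁ hGmem

end Summit.QuantumFields.YangMills.BalabanUVNodes.N12GaugeLetterLocExplicit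

end
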